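import Mathlib
import Summits.PneNP.PneNP.Theorems.ConvexRankGatesConvexGateBlindAffinePencilSix
import Summits.PneNP.PneNP.Theorems.ConvexRankGatesConvexGateBlindBlocks

/-!
# PneNP / ConvexRankGates — `ConvexGateBlind`: a valid pencil of size `6·C(m, k−2)` excludes EVERY bare `k`-clique

Helpers (`--supports stmt-PneNP-10680`), COLUMN-SPACE line (prover seat 2, session 26), PSD side; corollary of PROPOSITION L
(`…AffinePencilSix.lean`). Block-diagonal sums of valid pencils are valid and exclude the union of what the blocks exclude
(`blockDiagonal` of PSD blocks is PSD, `posSemidef_blockDiagonal_of_forall`; a non-PSD block is a principal submatrix). Summing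
the six-dimensional pencils of ALL `(k−2)`-sets `S` (every `k`-set contains one):

* `six_pencil_excludes_all` (registered) — **for `3 ≤ k` there is an affine pencil of size `q = 6·C(m, k−2)` that is
  positive semidefinite on every `k`-clique-free graph of `K_m` and NOT positive semidefinite at the bare clique of EVERY
  `k`-set**: `q_all(m, k) ≤ 6·C(m, k−2)`; for triangles (`k = 3`) size `6m` suffices (a covering design brings the paper
  bound to `6·Cov(m; k−2 ⊂ k)`, memo ANALYSIS-seat2-s26 §2.3 (iv)).

So for the dual-affine PSD+LP class of refutations of the crux (`C(m,k) ≤ R + c_H`, `…AffinePencilCount.lean`) the exclusion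
number gives NOTHING once the pencil has size `6·C(m,k−2)` — superpolynomial for `k = m^δ`, but for constant `k` polynomial:
lift-free spectrahedra of size `O(m^{k−2})` separate every bare `k`-clique from the `k`-clique-free polytope, whereas lift-free
POLYHEDRA need `C(m,k)` facets (`sandwiched_polyhedron_facets_ge_choose`, s24). [new]
-/

set_option linter.dupNamespace false

namespace Summit.PneNP.PneNP.Theorems

open Finset Real Matrix Literature.Computability.Complexity
open Summit.PneNP.PneNP.Cruxes.ConvexGateBlind.StrictRankConicCover (Edge cdist)

noncomputable section

namespace SixPencil

variable {m : ℕ}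

/-! ## Block-diagonal pencils -/

/-- `blockDiagonal` commutes with finite sums. [folklore] -/
theorem blockDiagonal_finset_sum {ι n o : Type*} [DecidableEq o] (s : Finset ι) (f : ι → o → Matrix n n ℝ) :
    blockDiagonal (∑ i ∈ s, f i) = ∑ i ∈ s, blockDiagonal (f i) := by
  classical
  induction s using Finset.induction_on with
  | empty => simp
  | insert x s hx ih => rw [Finset.sum_insert hx, Finset.sum_insert hx, blockDiagonal_add, ih]

/-- **A block-diagonal sum of pencils is the pencil of the block-diagonal sums.** [folklore] -/
theorem blockDiagonal_pencil {o n : Type*} [DecidableEq o] (A : o → Matrix n n ℝ) (B : o → Edge m → Matrix n n ℝ)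
    (u : Edge m → Bool) :
    (blockDiagonal A - ∑ e, if u e = true then blockDiagonal (fun t => B t e) else 0) =
      blockDiagonal fun t => A t - ∑ e, if u e = true then B t e else 0 := by
  classical
  have hfun : (fun t => A t - ∑ e, if u e = true then B t e else 0) =
      A - ∑ e, (fun t => if u e = true then B t e else (0 : Matrix n n ℝ)) := by
    funext t
    simp only [Pi.sub_apply, Finset.sum_apply]
  rw [hfun, blockDiagonal_sub, blockDiagonal_finset_sum]
  congr 1
  refine Finset.sum_congr rfl fun e _ => ?_
  split_ifs with h
  · rfl
  · exact (blockDiagonal_zero : blockDiagonal (0 : o → Matrix n n ℝ) = 0).symm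

/-- A block of a block-diagonal matrix is a principal submatrix, so a non-PSD block makes the whole matrix non-PSD. [folklore] -/
theorem not_posSemidef_blockDiagonal_of_block {o n : Type*} [DecidableEq o] [Fintype o] [Fintype n]
    (P : o → Matrix n n ℝ) (t : o) (ht : ¬ (P t).PosSemidef) : ¬ (blockDiagonal P).PosSemidef := by
  intro h
  apply ht
  have := h.submatrix (fun a : n => (a, t))
  rwa [submatrix_blockDiagonal_prod] at this

/-- `submatrix` commutes with finite sums. [folklore] -/
theorem submatrix_finset_sum {ι ι' κ : Type*} (eqv : ι' → ι) (s : Finset κ) (F : κ → Matrix ι ι ℝ) :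
    (∑ i ∈ s, F i).submatrix eqv eqv = ∑ i ∈ s, (F i).submatrix eqv eqv := by
  classical
  induction s using Finset.induction_on with
  | empty => simp
  | insert x s hx ih => rw [Finset.sum_insert hx, Finset.sum_insert hx, submatrix_add, Pi.add_apply, Pi.add_apply, ih]

/-- Reindexing a pencil along a map of index types preserves its shape. [folklore] -/
theorem submatrix_pencil {ι ι' : Type*} (eqv : ι' → ι) (A : Matrix ι ι ℝ) (B : Edge m → Matrix ι ι ℝ) (u : Edge m → Bool) :
    (A - ∑ e, if u e = true then B e else 0).submatrix eqv eqv =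
      A.submatrix eqv eqv - ∑ e, if u e = true then (B e).submatrix eqv eqv else 0 := by
  rw [submatrix_sub, Pi.sub_apply, Pi.sub_apply, submatrix_finset_sum]
  congr 1
  refine Finset.sum_congr rfl fun e _ => ?_
  split_ifs <;> simp

/-! ## All `(k−2)`-sets at once -/

/-- The index of blocks: the `(k−2)`-subsets of `[m]`. [new] -/
abbrev Blk (m k : ℕ) : Type := {S : Finset (Fin m) // S ∈ (Finset.univ : Finset (Fin m)).powersetCard (k - 2)}

/-- The block pencil: base matrix. [new] -/
def H0all (m k : ℕ) : Matrix (Fin 6 × Blk m k) (Fin 6 × Blk m k) ℝ := blockDiagonal fun t : Blk m k => H0 t.1 k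

/-- The block pencil: edge matrices. [new] -/
def HEall (m k : ℕ) (e : Edge m) : Matrix (Fin 6 × Blk m k) (Fin 6 × Blk m k) ℝ :=
  blockDiagonal fun t : Blk m k => HE t.1 k e

/-- **The block pencil is valid.** [new] -/
theorem all_pencil_posSemidef {k : ℕ} (hk : 3 ≤ k) (u : Edge m → Bool) (hu : cliqueFn m k u = false) :
    (H0all m k - ∑ e, if u e = true then HEall m k e else 0).PosSemidef := by
  rw [H0all, show (fun e => if u e = true then HEall m k e else 0) =
    fun e => if u e = true then blockDiagonal (fun t : Blk m k => HE t.1 k e) else 0 from rfl, blockDiagonal_pencil]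
  refine posSemidef_blockDiagonal_of_forall fun t => ?_
  have hS : t.1.card = k - 2 := (mem_powersetCard.1 t.2).2
  exact six_pencil_posSemidef hk hS u hu

/-- **The block pencil excludes every bare `k`-clique.** [new] -/
theorem all_pencil_excludes {k : ℕ} (hk : 3 ≤ k) (Q : Finset (Fin m)) (hQ : Q.card = k) :
    ¬ (H0all m k - ∑ e, if cliqueVec Q e = true then HEall m k e else 0).PosSemidef := by
  rw [H0all, show (fun e => if cliqueVec Q e = true then HEall m k e else 0) =
    fun e => if cliqueVec Q e = true then blockDiagonal (fun t : Blk m k => HE t.1 k e) else 0 from rfl, blockDiagonal_pencil]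
  -- a `(k−2)`-subset `S` of `Q`
  obtain ⟨S, hSQ, hS⟩ := Finset.exists_subset_card_eq (show k - 2 ≤ Q.card by omega)
  have hSmem : S ∈ (Finset.univ : Finset (Fin m)).powersetCard (k - 2) := mem_powersetCard.2 ⟨subset_univ _, hS⟩
  refine not_posSemidef_blockDiagonal_of_block _ ⟨S, hSmem⟩ ?_
  obtain ⟨a, b, ha, hb, hab, rfl⟩ := eq_insert_insert_of_superset hk hS hQ hSQ
  exact six_pencil_excludes hk hS ha hb hab

/-- The number of blocks times six. [folklore] -/
theorem card_index (m k : ℕ) : Fintype.card (Fin 6 × Blk m k) = 6 * m.choose (k - 2) := by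
  rw [Fintype.card_prod, Fintype.card_fin, Fintype.card_coe, card_powersetCard, card_univ, Fintype.card_fin]

end SixPencil

open Classical in
/-- **A valid pencil of size `6·C(m, k−2)` excludes every bare `k`-clique** (registered form): for `3 ≤ k` there are
`q = 6·C(m,k−2)` and `q × q` matrices `H₀, H_e` with `H₀ − Σ_{e ∈ u} H_e ⪰ 0` for every `k`-clique-free graph `u` of `K_m`
and `H₀ − Σ_{e ⊆ Q} H_e ⋡ 0` for EVERY `k`-set `Q` — the pencil exclusion number is everything, `c(q; m,k) = C(m,k)`, at size
`q = 6·C(m,k−2)` (block-diagonal sum of the six-dimensional pencils of Proposition L over all `(k−2)`-sets). [new] -/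
theorem six_pencil_excludes_all : ∀ {m k : ℕ}, 3 ≤ k → ∃ (q : ℕ) (H₀ : Matrix (Fin q) (Fin q) ℝ) (He : Edge m → Matrix (Fin q) (Fin q) ℝ), q = 6 * m.choose (k - 2) ∧ (∀ u : Edge m → Bool, cliqueFn m k u = false → (H₀ - ∑ e, if u e = true then He e else 0).PosSemidef) ∧ ∀ Q : Finset (Fin m), Q.card = k → ¬ (H₀ - ∑ e, if cliqueVec Q e = true then He e else 0).PosSemidef := by
  intro m k hk
  set q := 6 * m.choose (k - 2) with hq
  -- reindex the block pencil along `Fin q ≃ Fin 6 × Blk m k`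
  have hcard : Fintype.card (Fin 6 × SixPencil.Blk m k) = q := SixPencil.card_index m k
  let eqv : Fin q ≃ (Fin 6 × SixPencil.Blk m k) := (Fintype.equivFinOfCardEq hcard).symm
  refine ⟨q, (SixPencil.H0all m k).submatrix eqv eqv, fun e => (SixPencil.HEall m k e).submatrix eqv eqv, rfl,
    fun u hu => ?_, fun Q hQ => ?_⟩
  · rw [← SixPencil.submatrix_pencil]
    exact (SixPencil.all_pencil_posSemidef hk u hu).submatrix eqv
  · rw [← SixPencil.submatrix_pencil, Matrix.posSemidef_submatrix_equiv eqv]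
    exact SixPencil.all_pencil_excludes hk Q hQ

end

end Summit.PneNP.PneNP.Theorems
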